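import Mathlib
import Literature.Analysis.FluidPDE.BoxTransportConservation

/-!
# Stub `stub_fluxHeightInvariance` of the line `bernoulli-surface-topology` — crux
# `DyadicWallCascade.HalfSpaceHierarchy` (item stmt-AnomalousDissipation-18627): the mass flux and the
# energy flux of a periodic steady Euler conduit array do not depend on the height

Sorry-free discharge of the registered stub `stub_fluxHeightInvariance` of the lead's skeleton
(`Cruxes/HalfSpaceHierarchy/Lines/bernoulli_surface_topology.lean`).

**Statement.**  Let `G : ℝ³ → ℝ³`, `PG : ℝ³ → ℝ` be smooth, `div G = 0`
(`∑ᵢ (DG(X) eᵢ)ᵢ = 0`), steady Euler (`DG(X) (G X) + ∇PG (X) = 0`), and `1`-periodic in `x` and in `y`.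
Then for all heights `a, b`

* `∫_{[0,1]²} G₃ (q₁, q₂, b) dq = ∫_{[0,1]²} G₃ (q₁, q₂, a) dq` (mass flux), and
* `∫_{[0,1]²} G₃ (‖G‖² / 2 + PG) (q₁, q₂, b) dq = ∫_{[0,1]²} G₃ (‖G‖² / 2 + PG) (q₁, q₂, a) dq` (energy flux).

**Proof.**  `fluxHeight_faceFlux_eq_of_periodic`: for a differentiable field `W` on `ℝ³` that is
`1`-periodic in `x, y` and divergence free, Mathlib's divergence theorem on the box `[0,1]² × [a,b]`
(`MeasureTheory.integral_divergence_of_hasFDerivAt_off_countable`, transported from `EuclideanSpace ℝ (Fin 3)`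
to `Fin 3 → ℝ` by `EuclideanSpace.equiv`) reads `0 = ∑ faces`; the two pairs of lateral faces cancel by
periodicity, so the flux of `W₃` through the top face equals the flux through the bottom face; the face
integrals over `Fin 2 → ℝ` are converted to the registered `ℝ × ℝ` form by the measure-preserving
`MeasurableEquiv.finTwoArrow`.  The mass statement is the case
`W = G`; the energy statement is the case of the energy current `W = (‖G‖² / 2 + PG) G`, which is periodic
and divergence free: by the Leibniz rule (`BoxTransport.sum_fderiv_smul_apply`)
`div W = D(‖G‖²/2 + PG)[G] + (‖G‖²/2 + PG) div G = ⟪G, DG(G)⟫ + ⟪G, ∇PG⟫ = ⟪G, DG(G) + ∇PG⟫ = 0`.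
The case `b ≤ a` follows by symmetry.  Folklore (divergence theorem on a period box).
-/

-- `Summit.<Summit>.<Problem>` is the tree's mandated summit-side namespace (CONVENTIONS §2); for this
-- single-conjunct summit the two coincide, so the duplicate is deliberate.
set_option linter.dupNamespace false

open MeasureTheory Set
open scoped RealInnerProductSpace

noncomputable section

namespace Summit.AnomalousDissipation.AnomalousDissipation.Theorems.HalfSpaceHierarchy

/-- **Top flux equals bottom flux.**  For a differentiable vector field `W` on `ℝ³` which is `1`-periodic in
`x` and in `y` and divergence free, the flux of `W₃` through the unit period square at height `b` equals
the flux at height `a ≤ b`: the divergence theorem on the box `[0,1]² × [a,b]`, whose lateral faces cancel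
by periodicity. [folklore] -/
theorem fluxHeight_faceFlux_eq_of_periodic (W : EuclideanSpace ℝ (Fin 3) → EuclideanSpace ℝ (Fin 3))
    (hW : Differentiable ℝ W)
    (h0 : ∀ X : EuclideanSpace ℝ (Fin 3), W (X + EuclideanSpace.single 0 (1 : ℝ)) = W X)
    (h1 : ∀ X : EuclideanSpace ℝ (Fin 3), W (X + EuclideanSpace.single 1 (1 : ℝ)) = W X)
    (hdiv : ∀ X : EuclideanSpace ℝ (Fin 3),
      ∑ i : Fin 3, (fderiv ℝ W X (EuclideanSpace.single i (1 : ℝ))) i = 0)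
    {a b : ℝ} (hab : a ≤ b) :
    ∫ q in Icc (0 : ℝ) 1 ×ˢ Icc (0 : ℝ) 1, (W !₂[q.1, q.2, b]) 2 =
      ∫ q in Icc (0 : ℝ) 1 ×ˢ Icc (0 : ℝ) 1, (W !₂[q.1, q.2, a]) 2 := by
  -- the field in the coordinates `Fin 3 → ℝ`
  set eqv : EuclideanSpace ℝ (Fin 3) ≃L[ℝ] (Fin 3 → ℝ) := EuclideanSpace.equiv (Fin 3) ℝ with heqv
  have heqs : ∀ x, eqv.symm x = WithLp.toLp 2 x := fun x => rfl
  set f : (Fin 3 → ℝ) → (Fin 3 → ℝ) := fun x => eqv (W (eqv.symm x)) with hf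
  set f' : (Fin 3 → ℝ) → (Fin 3 → ℝ) →L[ℝ] (Fin 3 → ℝ) := fun x =>
    ((eqv : EuclideanSpace ℝ (Fin 3) →L[ℝ] (Fin 3 → ℝ)).comp (fderiv ℝ W (eqv.symm x))).comp
      (eqv.symm : (Fin 3 → ℝ) →L[ℝ] EuclideanSpace ℝ (Fin 3)) with hf'
  have hderiv : ∀ x, HasFDerivAt f (f' x) x := fun x =>
    (eqv.hasFDerivAt.comp _ (hW (eqv.symm x)).hasFDerivAt).comp x eqv.symm.hasFDerivAt
  have hcontf : Continuous f := eqv.continuous.comp (hW.continuous.comp eqv.symm.continuous)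
  -- the divergence in coordinates vanishes
  have hdiv_eq : ∀ x, ∑ i, f' x (Pi.single i 1) i = 0 := by
    intro x
    rw [← hdiv (eqv.symm x)]
    refine Finset.sum_congr rfl fun i _ => ?_
    simp only [hf', ContinuousLinearMap.comp_apply, ContinuousLinearEquiv.coe_coe]
    rfl
  -- the box `[0,1]² × [a,b]`
  set A : Fin 3 → ℝ := ![0, 0, a] with hA
  set B : Fin 3 → ℝ := ![1, 1, b] with hB
  have hAB : A ≤ B := fun i => by fin_cases i <;> simp [hA, hB, hab]
  have hDT := integral_divergence_of_hasFDerivAt_off_countable A B hAB f f' ∅ countable_empty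
    hcontf.continuousOn (fun x _ => hderiv x) (by simp_rw [hdiv_eq]; exact integrableOn_zero)
  simp_rw [hdiv_eq, integral_zero] at hDT
  rw [Fin.sum_univ_three] at hDT
  -- the lateral faces cancel by periodicity
  have hface0 : ∀ y : Fin 2 → ℝ, f (Fin.insertNth 0 (B 0) y) = f (Fin.insertNth 0 (A 0) y) := by
    intro y
    have : eqv.symm (Fin.insertNth 0 (B 0) y) =
        eqv.symm (Fin.insertNth 0 (A 0) y) + EuclideanSpace.single 0 (1 : ℝ) := by
      rw [heqs, heqs]
      ext i
      fin_cases i <;> (simp [hA, hB]; try rfl)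
    simp only [hf, this, h0]
  have hface1 : ∀ y : Fin 2 → ℝ, f (Fin.insertNth 1 (B 1) y) = f (Fin.insertNth 1 (A 1) y) := by
    intro y
    have : eqv.symm (Fin.insertNth 1 (B 1) y) =
        eqv.symm (Fin.insertNth 1 (A 1) y) + EuclideanSpace.single 1 (1 : ℝ) := by
      rw [heqs, heqs]
      ext i
      fin_cases i <;> (simp [hA, hB]; try rfl)
    simp only [hf, this, h1]
  simp_rw [hface0, hface1, sub_self, zero_add] at hDT
  -- the horizontal faces in the registered form (square integrals in the two spellings
  -- `Fin 2 → ℝ` and `ℝ × ℝ`; adapted from `lerayCapping_setIntegral_fin_two`)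
  have hfin2 : ∀ K : (Fin 2 → ℝ) → ℝ, ∫ x in Icc (0 : Fin 2 → ℝ) 1, K x =
      ∫ q in Icc (0 : ℝ) 1 ×ˢ Icc (0 : ℝ) 1, K ![q.1, q.2] := by
    intro K
    rw [← (volume_preserving_finTwoArrow ℝ).setIntegral_preimage_emb
      (MeasurableEquiv.finTwoArrow (α := ℝ)).measurableEmbedding (fun q : ℝ × ℝ => K ![q.1, q.2])
      (Icc (0 : ℝ) 1 ×ˢ Icc (0 : ℝ) 1)]
    have hpre : (MeasurableEquiv.finTwoArrow (α := ℝ)) ⁻¹' (Icc (0 : ℝ) 1 ×ˢ Icc (0 : ℝ) 1) =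
        Icc (0 : Fin 2 → ℝ) 1 := by
      ext x
      simp [Pi.le_def, Fin.forall_fin_two]
    rw [hpre]
    refine setIntegral_congr_fun measurableSet_Icc fun x _ => ?_
    congr 1
    funext i
    fin_cases i <;> simp
  have hsq : Icc (A ∘ Fin.succAbove 2) (B ∘ Fin.succAbove 2) = Icc (0 : Fin 2 → ℝ) 1 := by
    have hA' : A ∘ Fin.succAbove 2 = (0 : Fin 2 → ℝ) := by
      funext j; fin_cases j <;> rfl
    have hB' : B ∘ Fin.succAbove 2 = (1 : Fin 2 → ℝ) := by
      funext j; fin_cases j <;> rfl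
    rw [hA', hB']
  have hpt : ∀ (t : ℝ) (q : ℝ × ℝ),
      eqv.symm (Fin.insertNth (2 : Fin 3) t ![q.1, q.2]) = !₂[q.1, q.2, t] := by
    intro t q
    rw [heqs]
    ext i
    fin_cases i <;> rfl
  have hconv : ∀ t : ℝ,
      (∫ y in Icc (A ∘ Fin.succAbove 2) (B ∘ Fin.succAbove 2), f (Fin.insertNth 2 t y) 2) =
        ∫ q in Icc (0 : ℝ) 1 ×ˢ Icc (0 : ℝ) 1, (W !₂[q.1, q.2, t]) 2 := by
    intro t
    rw [hsq, hfin2]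
    refine setIntegral_congr_fun (measurableSet_Icc.prod measurableSet_Icc) fun q _ => ?_
    simp only [hf, hpt]
    rfl
  have hB2 : B 2 = b := by simp [hB]
  have hA2 : A 2 = a := by simp [hA]
  rw [hconv, hconv, hB2, hA2] at hDT
  exact sub_eq_zero.mp hDT.symm

/-- The derivative of the head `‖G‖² / 2 + PG` at a point of differentiability of `G` and `PG`. [folklore] -/
theorem fluxHeight_hasFDerivAt_head {G : EuclideanSpace ℝ (Fin 3) → EuclideanSpace ℝ (Fin 3)}
    {PG : EuclideanSpace ℝ (Fin 3) → ℝ} {X : EuclideanSpace ℝ (Fin 3)} (hG : DifferentiableAt ℝ G X)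
    (hP : DifferentiableAt ℝ PG X) :
    HasFDerivAt (fun Y => ‖G Y‖ ^ 2 / 2 + PG Y)
      ((2⁻¹ : ℝ) • (2 • (innerSL ℝ (G X)).comp (fderiv ℝ G X)) + fderiv ℝ PG X) X := by
  have h1 : HasFDerivAt (fun Y => ‖G Y‖ ^ 2 / 2)
      ((2⁻¹ : ℝ) • (2 • (innerSL ℝ (G X)).comp (fderiv ℝ G X))) X := by
    simpa only [div_eq_mul_inv] using hG.hasFDerivAt.norm_sq.mul_const (2⁻¹ : ℝ)
  exact h1.add hP.hasFDerivAt

/-- Directional derivative of the head: `D(‖G‖²/2 + PG)(X) v = ⟪G X, DG(X) v⟫ + DPG(X) v`. [folklore] -/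
theorem fluxHeight_fderiv_head_apply {G : EuclideanSpace ℝ (Fin 3) → EuclideanSpace ℝ (Fin 3)}
    {PG : EuclideanSpace ℝ (Fin 3) → ℝ} {X : EuclideanSpace ℝ (Fin 3)} (hG : DifferentiableAt ℝ G X)
    (hP : DifferentiableAt ℝ PG X) (v : EuclideanSpace ℝ (Fin 3)) :
    fderiv ℝ (fun Y => ‖G Y‖ ^ 2 / 2 + PG Y) X v = ⟪G X, fderiv ℝ G X v⟫ + fderiv ℝ PG X v := by
  rw [(fluxHeight_hasFDerivAt_head hG hP).fderiv]
  simp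

/-- **The energy current of a steady Euler flow is divergence free.**  If `G` is divergence free and
`DG(X) (G X) + ∇PG (X) = 0`, then `div ((‖G‖² / 2 + PG) G) = ⟪G, DG(G) + ∇PG⟫ = 0`. [folklore] -/
theorem fluxHeight_energyCurrent_div_eq_zero {G : EuclideanSpace ℝ (Fin 3) → EuclideanSpace ℝ (Fin 3)}
    {PG : EuclideanSpace ℝ (Fin 3) → ℝ} (hG : Differentiable ℝ G) (hP : Differentiable ℝ PG)
    (hdiv : ∀ X : EuclideanSpace ℝ (Fin 3),
      ∑ i : Fin 3, (fderiv ℝ G X (EuclideanSpace.single i (1 : ℝ))) i = 0)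
    (heul : ∀ X : EuclideanSpace ℝ (Fin 3), (fderiv ℝ G X) (G X) + gradient PG X = 0)
    (X : EuclideanSpace ℝ (Fin 3)) :
    ∑ i : Fin 3, (fderiv ℝ (fun Y => (‖G Y‖ ^ 2 / 2 + PG Y) • G Y) X
      (EuclideanSpace.single i (1 : ℝ))) i = 0 := by
  have hB : DifferentiableAt ℝ (fun Y => ‖G Y‖ ^ 2 / 2 + PG Y) X :=
    (fluxHeight_hasFDerivAt_head (hG X) (hP X)).differentiableAt
  rw [Literature.Analysis.FluidPDE.BoxTransport.sum_fderiv_smul_apply hB (hG X), hdiv X, mul_zero,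
    add_zero, fluxHeight_fderiv_head_apply (hG X) (hP X)]
  have hgrad : fderiv ℝ PG X (G X) = ⟪G X, gradient PG X⟫ := by
    rw [gradient, real_inner_comm, InnerProductSpace.toDual_symm_apply]
  rw [hgrad, ← inner_add_right, heul X, inner_zero_right]

/-- **Flux bookkeeping for a periodic steady Euler conduit array** (stub `stub_fluxHeightInvariance` of the
line `bernoulli-surface-topology`).  For a smooth, divergence-free, steady Euler pair `(G, PG)` on `ℝ³` that
is `1`-periodic in `x` and `y`, the mass flux `∫_{[0,1]²} G₃ (·, ·, z)` and the energy flux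
`∫_{[0,1]²} G₃ (‖G‖² / 2 + PG) (·, ·, z)` through the unit period square do not depend on the height `z`
(divergence theorem on `[0,1]² × [a,b]` for `G` and for the energy current `(‖G‖² / 2 + PG) G`).
[folklore] -/
theorem stub_fluxHeightInvariance :
    ∀ (G : EuclideanSpace ℝ (Fin 3) → EuclideanSpace ℝ (Fin 3)) (PG : EuclideanSpace ℝ (Fin 3) → ℝ),
      ContDiff ℝ ((⊤ : ℕ∞) : WithTop ℕ∞) G → ContDiff ℝ ((⊤ : ℕ∞) : WithTop ℕ∞) PG →
      (∀ X : EuclideanSpace ℝ (Fin 3), ∑ i : Fin 3, (fderiv ℝ G X (EuclideanSpace.single i (1 : ℝ))) i = 0) →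
      (∀ X : EuclideanSpace ℝ (Fin 3), (fderiv ℝ G X) (G X) + gradient PG X = 0) →
      (∀ X : EuclideanSpace ℝ (Fin 3),
        G (X + EuclideanSpace.single 0 (1 : ℝ)) = G X ∧ G (X + EuclideanSpace.single 1 (1 : ℝ)) = G X ∧
        PG (X + EuclideanSpace.single 0 (1 : ℝ)) = PG X ∧ PG (X + EuclideanSpace.single 1 (1 : ℝ)) = PG X) →
      ∀ a b : ℝ,
        (∫ q in Set.Icc (0 : ℝ) 1 ×ˢ Set.Icc (0 : ℝ) 1, (G !₂[q.1, q.2, b]) 2 =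
          ∫ q in Set.Icc (0 : ℝ) 1 ×ˢ Set.Icc (0 : ℝ) 1, (G !₂[q.1, q.2, a]) 2) ∧
        (∫ q in Set.Icc (0 : ℝ) 1 ×ˢ Set.Icc (0 : ℝ) 1,
            (G !₂[q.1, q.2, b]) 2 * (‖G !₂[q.1, q.2, b]‖ ^ 2 / 2 + PG !₂[q.1, q.2, b]) =
          ∫ q in Set.Icc (0 : ℝ) 1 ×ˢ Set.Icc (0 : ℝ) 1,
            (G !₂[q.1, q.2, a]) 2 * (‖G !₂[q.1, q.2, a]‖ ^ 2 / 2 + PG !₂[q.1, q.2, a])) := by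
  intro G PG hG hPG hdiv heul hper
  have hGd : Differentiable ℝ G := hG.differentiable (by simp)
  have hPd : Differentiable ℝ PG := hPG.differentiable (by simp)
  -- mass flux: the divergence theorem for `G`
  have hmass : ∀ a b : ℝ, a ≤ b →
      ∫ q in Icc (0 : ℝ) 1 ×ˢ Icc (0 : ℝ) 1, (G !₂[q.1, q.2, b]) 2 =
        ∫ q in Icc (0 : ℝ) 1 ×ˢ Icc (0 : ℝ) 1, (G !₂[q.1, q.2, a]) 2 := fun a b hab =>
    fluxHeight_faceFlux_eq_of_periodic G hGd (fun X => (hper X).1) (fun X => (hper X).2.1) hdiv hab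
  -- energy flux: the divergence theorem for the energy current `(‖G‖² / 2 + PG) G`
  have hWd : Differentiable ℝ (fun Y => (‖G Y‖ ^ 2 / 2 + PG Y) • G Y) := fun X =>
    (fluxHeight_hasFDerivAt_head (hGd X) (hPd X)).differentiableAt.fun_smul (hGd X)
  have hW0 : ∀ X : EuclideanSpace ℝ (Fin 3),
      (fun Y => (‖G Y‖ ^ 2 / 2 + PG Y) • G Y) (X + EuclideanSpace.single 0 (1 : ℝ)) =
        (fun Y => (‖G Y‖ ^ 2 / 2 + PG Y) • G Y) X := fun X => by
    simp only [(hper X).1, (hper X).2.2.1]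
  have hW1 : ∀ X : EuclideanSpace ℝ (Fin 3),
      (fun Y => (‖G Y‖ ^ 2 / 2 + PG Y) • G Y) (X + EuclideanSpace.single 1 (1 : ℝ)) =
        (fun Y => (‖G Y‖ ^ 2 / 2 + PG Y) • G Y) X := fun X => by
    simp only [(hper X).2.1, (hper X).2.2.2]
  have hE : ∀ t : ℝ,
      (∫ q in Icc (0 : ℝ) 1 ×ˢ Icc (0 : ℝ) 1,
          ((fun Y => (‖G Y‖ ^ 2 / 2 + PG Y) • G Y) !₂[q.1, q.2, t]) 2) =
        ∫ q in Icc (0 : ℝ) 1 ×ˢ Icc (0 : ℝ) 1,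
          (G !₂[q.1, q.2, t]) 2 * (‖G !₂[q.1, q.2, t]‖ ^ 2 / 2 + PG !₂[q.1, q.2, t]) := by
    intro t
    refine setIntegral_congr_fun (measurableSet_Icc.prod measurableSet_Icc) fun q _ => ?_
    simp only [PiLp.smul_apply, smul_eq_mul]
    ring
  have henergy : ∀ a b : ℝ, a ≤ b →
      ∫ q in Icc (0 : ℝ) 1 ×ˢ Icc (0 : ℝ) 1,
          (G !₂[q.1, q.2, b]) 2 * (‖G !₂[q.1, q.2, b]‖ ^ 2 / 2 + PG !₂[q.1, q.2, b]) =
        ∫ q in Icc (0 : ℝ) 1 ×ˢ Icc (0 : ℝ) 1,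
          (G !₂[q.1, q.2, a]) 2 * (‖G !₂[q.1, q.2, a]‖ ^ 2 / 2 + PG !₂[q.1, q.2, a]) := by
    intro a b hab
    rw [← hE b, ← hE a]
    exact fluxHeight_faceFlux_eq_of_periodic _ hWd hW0 hW1
      (fluxHeight_energyCurrent_div_eq_zero hGd hPd hdiv heul) hab
  intro a b
  rcases le_total a b with hab | hba
  · exact ⟨hmass a b hab, henergy a b hab⟩
  · exact ⟨(hmass b a hba).symm, (henergy b a hba).symm⟩

end Summit.AnomalousDissipation.AnomalousDissipation.Theorems.HalfSpaceHierarchy
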